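import Literature.Analysis.Complex.RungeParameters
import HarnessLib

/-!
# Approximation by entire maps on compact boxes in `ℂᵐ` (Grauert–Remmert, Kap. III §2, Korollar)

Let `Q = ∏_{i<m} [a_i, b_i] × [c_i, d_i] ⊂ ℂᵐ` be a compact box ("Quader") and `f` holomorphic
(Banach-space-valued) on a set containing the enlarged box `Q^η` (`η > 0`). Then for every `ε > 0`
there is an entire map `g` on `ℂᵐ` with `‖f − g‖ ≤ ε` on `Q` (`exists_entire_approx_on_box`); `g` is
built from polynomials in the first variable with coefficients approximated inductively, exactly as
in Grauert–Remmert, *Theorie der Steinschen Räume*, Kap. III §2.1, Korollar (Approximationssatz für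
Quader) to Satz 1 (`runge_rectangle_param`): `Q = R × Q'`, `f ≈ ∑ t_ν(z₁) f(ζ_ν, z')` on `R × Q'` with
polynomials `t_ν`, and by induction `f(ζ_ν, ·) ≈ ĝ_ν` on `Q'` with `ĝ_ν` entire on `ℂ^{m−1}`; then
`g(z) = ∑ t_ν(z₁) ĝ_ν(z')` is entire and `|f − g|_Q ≤ ε/2 + ∑_ν |t_ν|_R |f(ζ_ν, ·) − ĝ_ν|_{Q'} ≤ ε`.

(The same induction shows that `g` may be taken to be a polynomial; we only record entirety, which
is what the applications — Runge for `GL`-valued maps on boxes, exhaustions — use.)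

## References

* H. Grauert, R. Remmert, *Theorie der Steinschen Räume*, Grundlehren 227 (1977), Kap. III §2.1,
  Korollar zu Satz 1 [GrauertRemmert1977].
-/

noncomputable section

open Complex Set Filter Topology Metric

namespace Literature.Analysis.Complex

variable {F : Type*} [NormedAddCommGroup F] [NormedSpace ℂ F] [CompleteSpace F]

/-- `(w, z') ↦ (w, z'_0, …, z'_{m-1})` (`Fin.cons`) is complex-differentiable (it is linear).
[folklore] -/
theorem differentiable_finCons (m : ℕ) :
    Differentiable ℂ fun q : ℂ × (Fin m → ℂ) => (Fin.cons q.1 q.2 : Fin (m + 1) → ℂ) := by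
  refine differentiable_pi.2 fun i => ?_
  refine Fin.cases ?_ (fun j => ?_) i
  · simp only [Fin.cons_zero]
    exact differentiable_fst
  · simp only [Fin.cons_succ]
    exact differentiable_pi.1 differentiable_snd j

/-- `Fin.tail` is complex-differentiable (it is linear). [folklore] -/
theorem differentiable_finTail (m : ℕ) :
    Differentiable ℂ (Fin.tail : (Fin (m + 1) → ℂ) → Fin m → ℂ) :=
  differentiable_pi.2 fun j => differentiable_apply j.succ

/-- **Approximation on compact boxes** (Grauert–Remmert, Kap. III §2.1, Korollar zu Satz 1). If
`f : ℂᵐ → F` is holomorphic on a set `U` containing the enlarged compact box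
`∏ [a_i − η, b_i + η] × [c_i − η, d_i + η]` (`η > 0`, `a_i ≤ b_i`, `c_i ≤ d_i`), then for every
`ε > 0` there is an entire map `g : ℂᵐ → F` with `‖f(z) − g(z)‖ ≤ ε` on `∏ [a_i, b_i] × [c_i, d_i]`.
[cite: GrauertRemmert1977, Kap. III §2.1 Korollar] -/
theorem exists_entire_approx_on_box (m : ℕ) :
    ∀ {f : (Fin m → ℂ) → F} {U : Set (Fin m → ℂ)} {a b c d : Fin m → ℝ} {η ε : ℝ},
      0 < η → 0 < ε → (∀ i, a i ≤ b i) → (∀ i, c i ≤ d i) → DifferentiableOn ℂ f U →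
      Set.pi univ (fun i => Icc (a i - η) (b i + η) ×ℂ Icc (c i - η) (d i + η)) ⊆ U →
      ∃ g : (Fin m → ℂ) → F, Differentiable ℂ g ∧
        ∀ z ∈ Set.pi univ (fun i => Icc (a i) (b i) ×ℂ Icc (c i) (d i)), ‖f z - g z‖ ≤ ε := by
  induction m with
  | zero =>
    intro f U a b c d η ε hη hε hab hcd hf hU
    refine ⟨fun _ => f (fun i => Fin.elim0 i), differentiable_const _, fun z _ => ?_⟩
    rw [Subsingleton.elim z (fun i => Fin.elim0 i), sub_self, norm_zero]
    exact hε.le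
  | succ m ih =>
    intro f U a b c d η ε hη hε hab hcd hf hU
    -- `f` in the coordinates `(z₀, z') ∈ ℂ × ℂᵐ`
    set fc : ℂ × (Fin m → ℂ) → F := fun q => f (Fin.cons q.1 q.2) with hfc
    set Uc : Set (ℂ × (Fin m → ℂ)) := {q | (Fin.cons q.1 q.2 : Fin (m + 1) → ℂ) ∈ U} with hUc
    have hfcd : DifferentiableOn ℂ fc Uc :=
      hf.comp (differentiable_finCons m).differentiableOn fun q hq => hq
    -- the tail box (compact) and the enlarged tail box
    set K' : Set (Fin m → ℂ) := Set.pi univ fun j : Fin m =>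
      Icc (a j.succ) (b j.succ) ×ℂ Icc (c j.succ) (d j.succ) with hK'
    have hK'c : IsCompact K' := isCompact_univ_pi fun j => isCompact_Icc.reProdIm isCompact_Icc
    have hmemQη : ∀ (w : ℂ) (z' : Fin m → ℂ),
        w ∈ Icc (a 0 - η) (b 0 + η) ×ℂ Icc (c 0 - η) (d 0 + η) →
        (∀ j : Fin m, z' j ∈ Icc (a j.succ - η) (b j.succ + η) ×ℂ Icc (c j.succ - η) (d j.succ + η)) →
        (Fin.cons w z' : Fin (m + 1) → ℂ) ∈ U := by
      intro w z' hw hz'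
      refine hU fun i _ => ?_
      refine Fin.cases ?_ (fun j => ?_) i
      · simpa using hw
      · simpa using hz' j
    have hK'η : ∀ z' ∈ K', ∀ j : Fin m,
        z' j ∈ Icc (a j.succ - η) (b j.succ + η) ×ℂ Icc (c j.succ - η) (d j.succ + η) := by
      intro z' hz' j
      have h := hz' j (mem_univ j)
      exact ⟨⟨by linarith [h.1.1], by linarith [h.1.2]⟩, ⟨by linarith [h.2.1], by linarith [h.2.2]⟩⟩
    have hsub : (Icc (a 0 - η) (b 0 + η) ×ℂ Icc (c 0 - η) (d 0 + η)) ×ˢ K' ⊆ Uc := by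
      rintro ⟨w, z'⟩ ⟨hw, hz'⟩
      exact hmemQη w z' hw (hK'η z' hz')
    -- Runge with parameters in the first variable
    have hε2 : 0 < ε / 2 := half_pos hε
    obtain ⟨ι, _, ζ, t, hζ, happ⟩ :=
      runge_rectangle_param hfcd (hab 0) (hcd 0) hη hK'c hsub hε2
    -- induction hypothesis for the coefficients `f(ζ_i, ·)`
    have hcoef : ∀ i, DifferentiableOn ℂ (fun z' : Fin m → ℂ => f (Fin.cons (ζ i) z'))
        {z' | (Fin.cons (ζ i) z' : Fin (m + 1) → ℂ) ∈ U} := fun i =>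
      hf.comp ((differentiable_finCons m).comp
        (differentiable_const (ζ i) |>.prodMk differentiable_id)).differentiableOn fun z' hz' => hz'
    -- bounds for the polynomials on the rectangle
    have hR : IsCompact (Icc (a 0) (b 0) ×ℂ Icc (c 0) (d 0)) := isCompact_Icc.reProdIm isCompact_Icc
    have hT : ∀ i, ∃ T : ℝ, 0 ≤ T ∧ ∀ w ∈ Icc (a 0) (b 0) ×ℂ Icc (c 0) (d 0), ‖(t i).eval w‖ ≤ T := by
      intro i
      obtain ⟨T, hT⟩ := hR.exists_bound_of_continuousOn (f := fun w => (t i).eval w)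
        (t i).continuous.continuousOn
      exact ⟨max T 0, le_max_right _ _, fun w hw => (hT w hw).trans (le_max_left _ _)⟩
    choose T hT0 hT using hT
    set S : ℝ := ∑ i, T i with hS
    have hS0 : 0 ≤ S := Finset.sum_nonneg fun i _ => hT0 i
    set ε' : ℝ := ε / (2 * (S + 1)) with hε'
    have hε'0 : 0 < ε' := by positivity
    have hIH : ∀ i, ∃ g : (Fin m → ℂ) → F, Differentiable ℂ g ∧
        ∀ z' ∈ Set.pi univ (fun j : Fin m => Icc (a j.succ) (b j.succ) ×ℂ Icc (c j.succ) (d j.succ)),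
          ‖f (Fin.cons (ζ i) z') - g z'‖ ≤ ε' := fun i =>
      ih hη hε'0 (fun j => hab j.succ) (fun j => hcd j.succ) (hcoef i) fun z' hz' =>
        hmemQη (ζ i) z' (hζ i) fun j => hz' j (mem_univ j)
    choose ĝ hĝd hĝ using hIH
    -- the approximant
    refine ⟨fun z => ∑ i, (t i).eval (z 0) • ĝ i (Fin.tail z), ?_, ?_⟩
    · refine Differentiable.fun_sum fun i _ => ?_
      refine Differentiable.smul ?_ ((hĝd i).comp (differentiable_finTail m))
      exact (t i).differentiable.comp (differentiable_apply 0)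
    · intro z hz
      have hw : z 0 ∈ Icc (a 0) (b 0) ×ℂ Icc (c 0) (d 0) := hz 0 (mem_univ 0)
      have hz' : Fin.tail z ∈ K' := fun j _ => hz j.succ (mem_univ _)
      have hfz : f z = fc (z 0, Fin.tail z) := by simp [hfc, Fin.cons_self_tail]
      have h1 := happ (z 0) hw (Fin.tail z) hz'
      have h2 : ‖∑ i, (t i).eval (z 0) • fc (ζ i, Fin.tail z) -
          ∑ i, (t i).eval (z 0) • ĝ i (Fin.tail z)‖ ≤ S * ε' := by
        rw [← Finset.sum_sub_distrib]
        calc ‖∑ i, ((t i).eval (z 0) • fc (ζ i, Fin.tail z) - (t i).eval (z 0) • ĝ i (Fin.tail z))‖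
            ≤ ∑ i, T i * ε' := norm_sum_le_of_le _ fun i _ => by
              rw [← smul_sub]
              refine (norm_smul_le _ _).trans (mul_le_mul (hT i _ hw) ?_ (norm_nonneg _) (hT0 i))
              exact hĝ i (Fin.tail z) hz'
          _ = S * ε' := by rw [Finset.sum_mul]
      calc ‖f z - ∑ i, (t i).eval (z 0) • ĝ i (Fin.tail z)‖
          = ‖(fc (z 0, Fin.tail z) - ∑ i, (t i).eval (z 0) • fc (ζ i, Fin.tail z)) +
              (∑ i, (t i).eval (z 0) • fc (ζ i, Fin.tail z) -
                ∑ i, (t i).eval (z 0) • ĝ i (Fin.tail z))‖ := by rw [hfz, sub_add_sub_cancel]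
        _ ≤ ε / 2 + S * ε' := norm_add_le_of_le h1 h2
        _ ≤ ε / 2 + ε / 2 := by
            gcongr
            rw [hε', mul_div_assoc', div_le_div_iff₀ (by positivity) two_pos]
            nlinarith
        _ = ε := by ring

/-- Clamping a real number into `[a, b]` from the enlarged interval `[a − η, b + η]` moves it by at
most `η`. [folklore] -/
theorem clamp_mem_and_abs_sub_le {a b η x : ℝ} (hab : a ≤ b) (hη : 0 ≤ η)
    (hx : x ∈ Icc (a - η) (b + η)) :
    max a (min b x) ∈ Icc a b ∧ |x - max a (min b x)| ≤ η := by
  refine ⟨⟨le_max_left _ _, max_le hab (min_le_left _ _)⟩, ?_⟩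
  rcases le_total x a with hxa | hxa
  · rw [min_eq_right (hxa.trans hab), max_eq_left hxa, abs_sub_comm, abs_of_nonneg (by linarith)]
    linarith [hx.1]
  · rcases le_total x b with hxb | hxb
    · rw [min_eq_right hxb, max_eq_right hxa, sub_self, abs_zero]
      exact hη
    · rw [min_eq_left hxb, max_eq_right hab, abs_of_nonneg (by linarith)]
      linarith [hx.2]

/-- **Approximation on compact boxes, margin-free form**: for `f` holomorphic on an open `U`
containing the compact box `Q = ∏ [a_i, b_i] × [c_i, d_i]`, every `ε > 0` admits an entire `g` with
`‖f − g‖ ≤ ε` on `Q` (a margin `η` exists by compactness). [cite: GrauertRemmert1977, Kap. III §2.1 Korollar] -/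
theorem exists_entire_approx_on_box_of_isOpen {m : ℕ} {f : (Fin m → ℂ) → F} {U : Set (Fin m → ℂ)}
    (hUo : IsOpen U) (hf : DifferentiableOn ℂ f U) {a b c d : Fin m → ℝ}
    (hQU : Set.pi univ (fun i => Icc (a i) (b i) ×ℂ Icc (c i) (d i)) ⊆ U) {ε : ℝ} (hε : 0 < ε) :
    ∃ g : (Fin m → ℂ) → F, Differentiable ℂ g ∧
      ∀ z ∈ Set.pi univ (fun i => Icc (a i) (b i) ×ℂ Icc (c i) (d i)), ‖f z - g z‖ ≤ ε := by
  set Q : Set (Fin m → ℂ) := Set.pi univ (fun i => Icc (a i) (b i) ×ℂ Icc (c i) (d i)) with hQ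
  -- empty box: nothing to do
  rcases Q.eq_empty_or_nonempty with hQe | ⟨z₀, hz₀⟩
  · exact ⟨fun _ => 0, differentiable_const _, fun z hz => by rw [hQe] at hz; exact hz.elim⟩
  have hab : ∀ i, a i ≤ b i := fun i => (hz₀ i (mem_univ i)).1.1.trans (hz₀ i (mem_univ i)).1.2
  have hcd : ∀ i, c i ≤ d i := fun i => (hz₀ i (mem_univ i)).2.1.trans (hz₀ i (mem_univ i)).2.2
  -- a margin from compactness
  have hQc : IsCompact Q := isCompact_univ_pi fun i => isCompact_Icc.reProdIm isCompact_Icc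
  obtain ⟨δ, hδ0, hδU⟩ := hQc.exists_cthickening_subset_open hUo hQU
  set η : ℝ := δ / 2 with hη
  have hη0 : 0 < η := by positivity
  have hsub : Set.pi univ (fun i => Icc (a i - η) (b i + η) ×ℂ Icc (c i - η) (d i + η)) ⊆ U := by
    intro z hz
    -- clamp every coordinate into the box
    set w : Fin m → ℂ := fun i =>
      ⟨max (a i) (min (b i) (z i).re), max (c i) (min (d i) (z i).im)⟩ with hw
    have hwQ : w ∈ Q := fun i _ =>
      ⟨(clamp_mem_and_abs_sub_le (hab i) hη0.le (hz i (mem_univ i)).1).1,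
        (clamp_mem_and_abs_sub_le (hcd i) hη0.le (hz i (mem_univ i)).2).1⟩
    refine hδU (Metric.mem_cthickening_of_dist_le z w δ Q hwQ ?_)
    rw [dist_pi_le_iff hδ0.le]
    intro i
    rw [dist_eq_norm]
    refine (Complex.norm_le_abs_re_add_abs_im _).trans ?_
    have h1 := (clamp_mem_and_abs_sub_le (hab i) hη0.le (hz i (mem_univ i)).1).2
    have h2 := (clamp_mem_and_abs_sub_le (hcd i) hη0.le (hz i (mem_univ i)).2).2
    simp only [hw, sub_re, sub_im] at h1 h2 ⊢
    linarith
  exact exists_entire_approx_on_box m hη0 hε hab hcd hf hsub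

end Literature.Analysis.Complex
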